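import Mathlib
import HarnessLib
import Summits.AtomisticToContinuum.Crystallization.Theorems.ChartedPlanarOrderRigidityDoor
import Summits.AtomisticToContinuum.Crystallization.Theorems.ChartedPlanarOrderDensityDichotomyDoor
import Summits.AtomisticToContinuum.Crystallization.Theorems.ChartedPlanarOrderWindowCounting
import Summits.AtomisticToContinuum.Crystallization.Theorems.ChartedPlanarOrderMatchedRootBorel
import Summits.AtomisticToContinuum.Crystallization.Theorems.ChartedPlanarOrderBindingSurface

/-!
# The door on N 26636 with all three TRUE inputs discharged: residual = DOOR ∧ (BULK | R⋆)

decomp-a2c · N `stmt-AtomisticToContinuum-26636` (`ChartedZeroExcessLayered`, dial 1/50) · terminal by-name leaf (hand-1 g8).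
The translation node `RigidityDoor` (lens-3 g20) and the density dichotomy (lens-2 g21) reduce GAP(1/50) ∧ PERT(1/50) to
`MuEquilibriumDoor ∧ SparseNull(≤1/16) ∧ BindingSurface ∧ WindowCounting ∧ (R⋆ | BULK)`.  The three TRUE inputs are now tree
theorems — `WindowCounting` (hand-1 g7 p813143), `SparseNull ν ∀ν` (hand-1 g8 p815496), `BindingSurface` (hand-1 g8 p816066) — so:

* `sparseMisfit_of_bulk'`      : `BULK → SparseMisfit ν` (`0 < ν ≤ 1/16`), unconditionally in the TRUE inputs;
* `sparseMisfit_of_rigidity'`  : `R⋆ → SparseMisfit ν`;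
* `gap_and_pert_1_50_of_door_bulk`     : `MuEquilibriumDoor → BulkDefectGap → VisibleGap (1/50) ∧ PertRegime (1/50)`;
* `gap_and_pert_1_50_of_door_rigidity` : `MuEquilibriumDoor → DiscreteBarlowRigidity → VisibleGap (1/50) ∧ PertRegime (1/50)`.

Beneath the door, the residual of record on N is therefore exactly `MuEquilibriumDoor` (stmt-27073, farm-blocked closer) ∧ `BULK`
(`BulkDefectGap`, lens-2) — or R⋆ (`stmt-28120`).  DEF-FREE; axioms standard.
-/

noncomputable section

namespace Summit.AtomisticToContinuum.Crystallization.Theorems.ChartedPlanarOrderDoorAssembly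

open Summit.AtomisticToContinuum.Crystallization.Theorems.ChartedPlanarOrderRigidityDoor
open Summit.AtomisticToContinuum.Crystallization.Theorems.ChartedPlanarOrderDensityDichotomy
open Summit.AtomisticToContinuum.Crystallization.Theorems.ChartedPlanarOrderWindowCounting (windowCounting_holds)
open Summit.AtomisticToContinuum.Crystallization.Theorems.ChartedPlanarOrderMatchedRootBorel (sparseNull_holds)
open Summit.AtomisticToContinuum.Crystallization.Theorems.ChartedPlanarOrderBindingSurface (bindingSurface_holds)

/-- **BULK ⟹ D♯(ν)** for `0 < ν ≤ 1/16`, with BindingSurface and WindowCounting discharged. [this work] -/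
theorem sparseMisfit_of_bulk' {ν : ℝ} (hν : 0 < ν) (hν' : ν ≤ 1 / 16) (hBu : BulkDefectGap) : SparseMisfit ν :=
  sparseMisfit_of_bulk hν hν' hBu bindingSurface_holds windowCounting_holds

/-- **R⋆ ⟹ D♯(ν)** for `0 < ν ≤ 1/16`, with BindingSurface and WindowCounting discharged. [this work] -/
theorem sparseMisfit_of_rigidity' {ν : ℝ} (hν : 0 < ν) (hν' : ν ≤ 1 / 16) (hR : DiscreteBarlowRigidity) : SparseMisfit ν :=
  sparseMisfit_of_rigidity hν hν' hR bindingSurface_holds windowCounting_holds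

/-- **DOOR ∧ BULK ⟹ GAP(1/50) ∧ PERT(1/50)** — all three TRUE inputs (SparseNull ∀ν, BindingSurface, WindowCounting) discharged by name.
[this work] -/
theorem gap_and_pert_1_50_of_door_bulk
    (hD : Summit.AtomisticToContinuum.Crystallization.Theses.GrainCoreNetworkSplit.MuEquilibriumDoor)
    (hBu : BulkDefectGap) : VisibleGap (1 / 50) ∧ PertRegime (1 / 50) :=
  gap_and_pert_1_50_of_bulk hD (fun η _ _ => sparseNull_holds η) hBu bindingSurface_holds windowCounting_holds

/-- **DOOR ∧ R⋆ ⟹ GAP(1/50) ∧ PERT(1/50)** — the same with the roof R⋆ (`stmt-AtomisticToContinuum-28120`) in place of BULK. [this work] -/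
theorem gap_and_pert_1_50_of_door_rigidity
    (hD : Summit.AtomisticToContinuum.Crystallization.Theses.GrainCoreNetworkSplit.MuEquilibriumDoor)
    (hR : DiscreteBarlowRigidity) : VisibleGap (1 / 50) ∧ PertRegime (1 / 50) :=
  gap_and_pert_1_50_of_rigidity hD (fun η _ _ => sparseNull_holds η) hR bindingSurface_holds windowCounting_holds

/-- **D♯(ν) alone ⟹ GAP(ν)** given the door, for every `ν` (SparseNull discharged). [this work] -/
theorem visibleGap_of_door_sparseMisfit (ν : ℝ)
    (hD : Summit.AtomisticToContinuum.Crystallization.Theses.GrainCoreNetworkSplit.MuEquilibriumDoor)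
    (hS : SparseMisfit ν) : VisibleGap ν :=
  visibleGap_of_door_sparse ν hD (sparseNull_holds ν) hS

/-- **D♯(≤1/16) ⟹ PERT(ν)** given the door (SparseNull discharged). [this work] -/
theorem pertRegime_of_door_sparseMisfit (ν : ℝ)
    (hD : Summit.AtomisticToContinuum.Crystallization.Theses.GrainCoreNetworkSplit.MuEquilibriumDoor)
    (hS : ∀ η : ℝ, 0 < η → η ≤ 1 / 16 → SparseMisfit η) : PertRegime ν :=
  pertRegime_of_door_sparse ν hD (fun η _ _ => sparseNull_holds η) hS

end Summit.AtomisticToContinuum.Crystallization.Theorems.ChartedPlanarOrderDoorAssembly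

end
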